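import Mathlib
import HarnessLib

/-!
# Route `KLProgramme` — crux K3 ENGINE (stmt-HubbardSuperconductivity-20437) stub (b) conj. 2 «(c-D)² FAMILY TELESCOPE», brick (D5f): the closed
# defect amplitude `A₀^Δ` of k3c4-p2's `sliceDefectPairWt_bgmFat_le` in the TWO-SCALE CLASS of a flow piece — `A₀^Δ(x) ≤ A₀^♯/x²`

Cell `gate-hubbard-kl`, seat hubbard-kl-k3c3-p2 (g11); F1-DESIGN §10 (cov-defect half of the simultaneous telescope).  In
`…SectorSliceDefectPairFat.sliceDefectPairWt_bgmFat_le` (frames `K, K′`, fat family on a third frame, ANY positive rates) the amplitude `A₀^Δ` is a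
polynomial in the increment data `P₀ … P₃` with every monomial carrying one `P_j`.  For a flow piece at depth `x ≥ 1` (`P₀ = Q₀/x²`, `P₁ = Q₁/x`,
`P₂ = Q₂`, `P₃ = Q₃x`; band third datum `K₃ = K₃♯·x`, frame datum `κ₃F = κ_A + κ_B·x`) and the rates `s₁ = ρ/x`, `s₂ = s₃′ = ρ₂/x`, `s₃ = ρ₃/x`
(`s₀` free), every group of `A₀^Δ` is `≤ (its value at x = 1 with P ↦ Q)/x²`:

* `defectX_scale` — `X₀(x) = X₀♯/x²`, `X₁(x) ≤ X₁♯`, `X₂(x) ≤ X₂♯`, `X₃(x) ≤ x·X₃♯`, `T_t(x) = T_t♯/x²`;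
* **`sliceDefect_amp_twoScale_le`** — `A₀^Δ(x) ≤ A₀^♯/x²` (so, after the weight comparison `× Λ_j x/ρ` and `√W ≤ x·√Ŵ`, every piece costs the
  same `x`-free amount — no threshold conditions on the covariance side).

Pure real algebra; no definitions, no sorry.  Nothing asserts superconductivity. [cite: BenfattoGiulianiMastropietro2006, §3 (3.2)–(3.8)]
-/

noncomputable section

namespace Summit.HubbardSuperconductivity.HubbardSuperconductivity.Theorems.TorusFourierL2

set_option linter.dupNamespace false -- summit = problem name (single-conjunct summit), D-0017

section Scale

variable {k1c k2c k3c k4c K₁ K₂ K₃s Q₀ Q₁ Q₂ Q₃ x : ℝ}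
  (hk1 : 0 ≤ k1c) (hk2 : 0 ≤ k2c) (hk3 : 0 ≤ k3c) (hk4 : 0 ≤ k4c) (hK₁ : 0 ≤ K₁) (hK₂ : 0 ≤ K₂) (hK₃ : 0 ≤ K₃s)
  (hQ₀ : 0 ≤ Q₀) (hQ₁ : 0 ≤ Q₁) (hQ₂ : 0 ≤ Q₂) (hQ₃ : 0 ≤ Q₃) (hx : 1 ≤ x)

include hk1 hk2 hk3 hk4 hK₁ hK₂ hK₃ hQ₀ hQ₁ hQ₂ hQ₃ hx in
set_option maxHeartbeats 800000 in
/-- **The defect polynomials in the two-scale class**: with `P₀ = Q₀/x²`, `P₁ = Q₁/x`, `P₂ = Q₂`, `P₃ = Q₃x`, `K₃ = K₃♯x` (`x ≥ 1`):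
`X₁ ≤ X₁♯`, `X₂ ≤ X₂♯`, `X₃ ≤ x·X₃♯` where `♯` means `P ↦ Q`, `K₃ ↦ K₃♯` (the `x = 1` values). [cite: BenfattoGiulianiMastropietro2006, §3 (3.2)] -/
theorem defectX_scale :
    k2c * (Q₀ / x ^ 2) * (K₁ + Q₁ / x) + k1c * (Q₁ / x) ≤ k2c * Q₀ * (K₁ + Q₁) + k1c * Q₁ ∧
    k3c * (Q₀ / x ^ 2) * (K₁ + Q₁ / x) ^ 2 + k2c * (Q₁ / x * (2 * K₁ + Q₁ / x)) + (k2c * (Q₀ / x ^ 2) * (K₂ + Q₂) + k1c * Q₂) ≤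
      k3c * Q₀ * (K₁ + Q₁) ^ 2 + k2c * (Q₁ * (2 * K₁ + Q₁)) + (k2c * Q₀ * (K₂ + Q₂) + k1c * Q₂) ∧
    k4c * (Q₀ / x ^ 2) * (K₁ + Q₁ / x) ^ 3 + k3c * (Q₁ / x * (3 * K₁ ^ 2 + 3 * K₁ * (Q₁ / x) + (Q₁ / x) ^ 2)) +
        3 * (k3c * (Q₀ / x ^ 2) * ((K₁ + Q₁ / x) * (K₂ + Q₂)) + k2c * (K₁ * Q₂ + Q₁ / x * K₂ + Q₁ / x * Q₂)) +
        (k2c * (Q₀ / x ^ 2) * (K₃s * x + Q₃ * x) + k1c * (Q₃ * x)) ≤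
      x * (k4c * Q₀ * (K₁ + Q₁) ^ 3 + k3c * (Q₁ * (3 * K₁ ^ 2 + 3 * K₁ * Q₁ + Q₁ ^ 2)) +
        3 * (k3c * Q₀ * ((K₁ + Q₁) * (K₂ + Q₂)) + k2c * (K₁ * Q₂ + Q₁ * K₂ + Q₁ * Q₂)) + (k2c * Q₀ * (K₃s + Q₃) + k1c * Q₃)) := by
  have hx0 : 0 < x := lt_of_lt_of_le one_pos hx
  have hix : 1 / x ≤ 1 := by rw [div_le_one hx0]; exact hx
  have hix2 : 1 / x ^ 2 ≤ 1 := by rw [div_le_one (by positivity)]; exact one_le_pow₀ hx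
  have bP₀ : Q₀ / x ^ 2 ≤ Q₀ := by
    rw [show Q₀ / x ^ 2 = Q₀ * (1 / x ^ 2) by ring]; exact (mul_le_mul_of_nonneg_left hix2 hQ₀).trans (le_of_eq (mul_one _))
  have bP₁ : Q₁ / x ≤ Q₁ := by
    rw [show Q₁ / x = Q₁ * (1 / x) by ring]; exact (mul_le_mul_of_nonneg_left hix hQ₁).trans (le_of_eq (mul_one _))
  have hP₀ : 0 ≤ Q₀ / x ^ 2 := by positivity
  have hP₁ : 0 ≤ Q₁ / x := by positivity
  have s1 : K₁ + Q₁ / x ≤ K₁ + Q₁ := by linarith only [bP₁]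
  have s10 : 0 ≤ K₁ + Q₁ / x := by positivity
  refine ⟨?_, ?_, ?_⟩
  · have t1 : k2c * (Q₀ / x ^ 2) * (K₁ + Q₁ / x) ≤ k2c * Q₀ * (K₁ + Q₁) :=
      mul_le_mul (mul_le_mul_of_nonneg_left bP₀ hk2) s1 s10 (by positivity)
    have t2 : k1c * (Q₁ / x) ≤ k1c * Q₁ := mul_le_mul_of_nonneg_left bP₁ hk1
    linarith only [t1, t2]
  · have t1 : k3c * (Q₀ / x ^ 2) * (K₁ + Q₁ / x) ^ 2 ≤ k3c * Q₀ * (K₁ + Q₁) ^ 2 :=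
      mul_le_mul (mul_le_mul_of_nonneg_left bP₀ hk3) (pow_le_pow_left₀ s10 s1 2) (by positivity) (by positivity)
    have t2 : Q₁ / x * (2 * K₁ + Q₁ / x) ≤ Q₁ * (2 * K₁ + Q₁) := mul_le_mul bP₁ (by linarith only [bP₁]) (by positivity) hQ₁
    have t3 : k2c * (Q₀ / x ^ 2) * (K₂ + Q₂) ≤ k2c * Q₀ * (K₂ + Q₂) := mul_le_mul_of_nonneg_right (mul_le_mul_of_nonneg_left bP₀ hk2) (by positivity)
    have t2' := mul_le_mul_of_nonneg_left t2 hk2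
    linarith only [t1, t2', t3]
  · -- order three: every monomial has net degree `≤ 1` in `x`
    have hx1 : ∀ {y : ℝ}, 0 ≤ y → y ≤ x * y := fun {y} hy => le_mul_of_one_le_left hy hx
    have t1 : k4c * (Q₀ / x ^ 2) * (K₁ + Q₁ / x) ^ 3 ≤ k4c * Q₀ * (K₁ + Q₁) ^ 3 :=
      mul_le_mul (mul_le_mul_of_nonneg_left bP₀ hk4) (pow_le_pow_left₀ s10 s1 3) (by positivity) (by positivity)
    have t2 : Q₁ / x * (3 * K₁ ^ 2 + 3 * K₁ * (Q₁ / x) + (Q₁ / x) ^ 2) ≤ Q₁ * (3 * K₁ ^ 2 + 3 * K₁ * Q₁ + Q₁ ^ 2) := by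
      refine mul_le_mul bP₁ ?_ (by positivity) hQ₁
      have := mul_le_mul_of_nonneg_left bP₁ (by positivity : 0 ≤ 3 * K₁)
      have := pow_le_pow_left₀ hP₁ bP₁ 2
      linarith
    have t3 : k3c * (Q₀ / x ^ 2) * ((K₁ + Q₁ / x) * (K₂ + Q₂)) ≤ k3c * Q₀ * ((K₁ + Q₁) * (K₂ + Q₂)) :=
      mul_le_mul (mul_le_mul_of_nonneg_left bP₀ hk3) (mul_le_mul_of_nonneg_right s1 (by positivity)) (by positivity) (by positivity)
    have t4 : K₁ * Q₂ + Q₁ / x * K₂ + Q₁ / x * Q₂ ≤ K₁ * Q₂ + Q₁ * K₂ + Q₁ * Q₂ := by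
      have := mul_le_mul_of_nonneg_right bP₁ hK₂
      have := mul_le_mul_of_nonneg_right bP₁ hQ₂
      linarith
    have t5 : k2c * (Q₀ / x ^ 2) * (K₃s * x + Q₃ * x) ≤ x * (k2c * Q₀ * (K₃s + Q₃)) := by
      -- `(Q₀/x²)·(K₃♯ + Q₃)·x = Q₀(K₃♯+Q₃)/x ≤ x·Q₀(K₃♯+Q₃)`
      have e : k2c * (Q₀ / x ^ 2) * (K₃s * x + Q₃ * x) = (k2c * Q₀ * (K₃s + Q₃)) * (1 / x) := by field_simp
      rw [e]
      have h0 : 0 ≤ k2c * Q₀ * (K₃s + Q₃) := by positivity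
      calc (k2c * Q₀ * (K₃s + Q₃)) * (1 / x) ≤ (k2c * Q₀ * (K₃s + Q₃)) * 1 := mul_le_mul_of_nonneg_left hix h0
        _ ≤ x * (k2c * Q₀ * (K₃s + Q₃)) := by rw [mul_one]; exact hx1 h0
    have t6 : k1c * (Q₃ * x) = x * (k1c * Q₃) := by ring
    have u1 := hx1 (show 0 ≤ k4c * Q₀ * (K₁ + Q₁) ^ 3 by positivity)
    have u2 := hx1 (show 0 ≤ k3c * (Q₁ * (3 * K₁ ^ 2 + 3 * K₁ * Q₁ + Q₁ ^ 2)) by positivity)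
    have u3 := hx1 (show 0 ≤ 3 * (k3c * Q₀ * ((K₁ + Q₁) * (K₂ + Q₂)) + k2c * (K₁ * Q₂ + Q₁ * K₂ + Q₁ * Q₂)) by positivity)
    have t2' := mul_le_mul_of_nonneg_left t2 hk3
    have t4' := mul_le_mul_of_nonneg_left t4 hk2
    nlinarith only [t1, t2', t3, t4', t5, t6, u1, u2, u3]

end Scale

section Amp

set_option maxHeartbeats 1600000 in
/-- **The closed defect amplitude in the two-scale class: `A₀^Δ(x) ≤ A₀^♯/x²`.**  Hypotheses: the polynomials `X_k(x)`, `X_k♯`, `T_t(x) = T_t♯/x²`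
(abbreviation hypotheses in the form produced by `sliceDefectPairWt_bgmFat_le` with the substitutions of `defectX_scale`), the frame datum
`κ₃F = κ_A + κ_B x`, nonnegative x-free brackets `Ae1, Ae2, An1, An2, Av1, Av2`, step lengths `ℓ₁, ℓ`, rates `s₁ = ρ/x`, `s₂ = s₃′ = ρ₂/x`,
`s₃ = ρ₃/x`. [cite: BenfattoGiulianiMastropietro2006, §3 (3.2)–(3.8)] -/
theorem sliceDefect_amp_twoScale_le {c₀ Λm ℓ₁ ℓ κA κB Ae1 Ae2 An1 An2 Av1 Av2 X₀ X₁ X₂ X₃ X₀s X₁s X₂s X₃s Tt Tts x ρ ρ₂ ρ₃ s₀ L P : ℝ}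
    (hc₀ : 0 ≤ c₀) (hΛm : 0 < Λm) (hℓ₁ : 0 ≤ ℓ₁) (hℓ : 0 ≤ ℓ) (hκA : 0 ≤ κA) (hκB : 0 ≤ κB) (hAe1 : 0 ≤ Ae1) (hAe2 : 0 ≤ Ae2)
    (hAn1 : 0 ≤ An1) (hAn2 : 0 ≤ An2) (hAv1 : 0 ≤ Av1) (hAv2 : 0 ≤ Av2) (hx : 1 ≤ x) (hρ : 0 < ρ) (hρ₂ : 0 < ρ₂) (hρ₃ : 0 < ρ₃) (hs₀ : 0 < s₀)
    (hL : 0 < L) (hP : 0 < P)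
    (hX₀0 : 0 ≤ X₀s) (hX₁0 : 0 ≤ X₁s) (hX₂0 : 0 ≤ X₂s) (hX₃0 : 0 ≤ X₃s)
    (hX₀ : X₀ = X₀s / x ^ 2) (hX₁ : X₁ ≤ X₁s) (hX₂ : X₂ ≤ X₂s) (hX₃ : X₃ ≤ x * X₃s) (hTt : Tt = Tts / x ^ 2) :
    c₀ * X₀ + Tt / (4 / (s₀ * P)) ^ 3 +
      c₀ * ((Real.sqrt 2 * ℓ₁) ^ 3 * X₃ + 3 * (Ae1 * ((Real.sqrt 2 * ℓ₁) ^ 2 * X₂)) + 3 * (Ae2 * ((Real.sqrt 2 * ℓ₁) * X₁)) +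
        (κA + κB * x) * ℓ₁ ^ 3 / Λm ^ 3 * X₀) / (4 / (ρ / x * L)) ^ 3 +
      c₀ * ((Real.sqrt 2 * ℓ) ^ 3 * X₃ + 3 * (An1 * ((Real.sqrt 2 * ℓ) ^ 2 * X₂)) + 3 * (An2 * ((Real.sqrt 2 * ℓ) * X₁)) +
        (κA + κB * x) * ℓ ^ 3 / Λm ^ 3 * X₀) / (4 / (ρ₂ / x * L)) ^ 3 +
      c₀ * ((Real.sqrt 2 * ℓ) ^ 2 * X₂ + 2 * (Av1 * ((Real.sqrt 2 * ℓ) * X₁)) + Av2 * X₀) / (4 / (ρ₃ / x * L)) ^ 2 +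
      c₀ * ((Real.sqrt 2 * ℓ) ^ 3 * X₃ + 3 * (Av1 * ((Real.sqrt 2 * ℓ) ^ 2 * X₂)) + 3 * (Av2 * ((Real.sqrt 2 * ℓ) * X₁)) +
        (κA + κB * x) * ℓ ^ 3 / Λm ^ 3 * X₀) / (4 / (ρ₂ / x * L)) ^ 3 ≤
    (c₀ * X₀s + Tts / (4 / (s₀ * P)) ^ 3 +
      c₀ * ((Real.sqrt 2 * ℓ₁) ^ 3 * X₃s + 3 * (Ae1 * ((Real.sqrt 2 * ℓ₁) ^ 2 * X₂s)) + 3 * (Ae2 * ((Real.sqrt 2 * ℓ₁) * X₁s)) +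
        (κA + κB) * ℓ₁ ^ 3 / Λm ^ 3 * X₀s) / (4 / (ρ * L)) ^ 3 +
      c₀ * ((Real.sqrt 2 * ℓ) ^ 3 * X₃s + 3 * (An1 * ((Real.sqrt 2 * ℓ) ^ 2 * X₂s)) + 3 * (An2 * ((Real.sqrt 2 * ℓ) * X₁s)) +
        (κA + κB) * ℓ ^ 3 / Λm ^ 3 * X₀s) / (4 / (ρ₂ * L)) ^ 3 +
      c₀ * ((Real.sqrt 2 * ℓ) ^ 2 * X₂s + 2 * (Av1 * ((Real.sqrt 2 * ℓ) * X₁s)) + Av2 * X₀s) / (4 / (ρ₃ * L)) ^ 2 +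
      c₀ * ((Real.sqrt 2 * ℓ) ^ 3 * X₃s + 3 * (Av1 * ((Real.sqrt 2 * ℓ) ^ 2 * X₂s)) + 3 * (Av2 * ((Real.sqrt 2 * ℓ) * X₁s)) +
        (κA + κB) * ℓ ^ 3 / Λm ^ 3 * X₀s) / (4 / (ρ₂ * L)) ^ 3) / x ^ 2 := by
  have hx0 : 0 < x := lt_of_lt_of_le one_pos hx
  have hx2 : 0 < x ^ 2 := by positivity
  have hs2 : 0 ≤ Real.sqrt 2 := Real.sqrt_nonneg 2
  -- bracket scalings: order three `≤ x·♯`, order two `≤ ♯`, the `κ₃F·X₀` member `≤ x·♯`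
  have hx1 : ∀ {y : ℝ}, 0 ≤ y → y ≤ x * y := fun {y} hy => le_mul_of_one_le_left hy hx
  have hκX : (κA + κB * x) * X₀ ≤ x * ((κA + κB) * X₀s) := by
    rw [hX₀]
    -- `(κA + κB x)·X₀♯/x² ≤ (κA + κB)·x·X₀♯ … crude: κA/x² ≤ κA x, κB x/x² ≤ κB x`
    have h1 : κA * (X₀s / x ^ 2) ≤ x * (κA * X₀s) := by
      have : X₀s / x ^ 2 ≤ X₀s := by
        rw [div_le_iff₀ hx2]; exact le_mul_of_one_le_right hX₀0 (one_le_pow₀ hx)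
      calc κA * (X₀s / x ^ 2) ≤ κA * X₀s := mul_le_mul_of_nonneg_left this hκA
        _ ≤ x * (κA * X₀s) := hx1 (by positivity)
    have h2 : κB * x * (X₀s / x ^ 2) ≤ x * (κB * X₀s) := by
      have e : κB * x * (X₀s / x ^ 2) = (κB * X₀s) * (1 / x) := by field_simp
      rw [e]
      have hix : 1 / x ≤ 1 := by rw [div_le_one hx0]; exact hx
      calc (κB * X₀s) * (1 / x) ≤ (κB * X₀s) * 1 := mul_le_mul_of_nonneg_left hix (by positivity)
        _ ≤ x * (κB * X₀s) := by rw [mul_one]; exact hx1 (by positivity)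
    nlinarith only [h1, h2]
  have br3 : ∀ {l a1 a2 : ℝ}, 0 ≤ l → 0 ≤ a1 → 0 ≤ a2 →
      (Real.sqrt 2 * l) ^ 3 * X₃ + 3 * (a1 * ((Real.sqrt 2 * l) ^ 2 * X₂)) + 3 * (a2 * ((Real.sqrt 2 * l) * X₁)) + (κA + κB * x) * l ^ 3 / Λm ^ 3 * X₀ ≤
      x * ((Real.sqrt 2 * l) ^ 3 * X₃s + 3 * (a1 * ((Real.sqrt 2 * l) ^ 2 * X₂s)) + 3 * (a2 * ((Real.sqrt 2 * l) * X₁s)) + (κA + κB) * l ^ 3 / Λm ^ 3 * X₀s) := by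
    intro l a1 a2 hl ha1 ha2
    have t1 : (Real.sqrt 2 * l) ^ 3 * X₃ ≤ x * ((Real.sqrt 2 * l) ^ 3 * X₃s) := by
      calc (Real.sqrt 2 * l) ^ 3 * X₃ ≤ (Real.sqrt 2 * l) ^ 3 * (x * X₃s) := mul_le_mul_of_nonneg_left hX₃ (by positivity)
        _ = x * ((Real.sqrt 2 * l) ^ 3 * X₃s) := by ring
    have t2 : a1 * ((Real.sqrt 2 * l) ^ 2 * X₂) ≤ x * (a1 * ((Real.sqrt 2 * l) ^ 2 * X₂s)) :=
      (mul_le_mul_of_nonneg_left (mul_le_mul_of_nonneg_left hX₂ (by positivity)) ha1).trans (hx1 (by positivity))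
    have t3 : a2 * ((Real.sqrt 2 * l) * X₁) ≤ x * (a2 * ((Real.sqrt 2 * l) * X₁s)) :=
      (mul_le_mul_of_nonneg_left (mul_le_mul_of_nonneg_left hX₁ (by positivity)) ha2).trans (hx1 (by positivity))
    have t4 : (κA + κB * x) * l ^ 3 / Λm ^ 3 * X₀ ≤ x * ((κA + κB) * l ^ 3 / Λm ^ 3 * X₀s) := by
      have e1 : (κA + κB * x) * l ^ 3 / Λm ^ 3 * X₀ = (l ^ 3 / Λm ^ 3) * ((κA + κB * x) * X₀) := by ring
      have e2 : x * ((κA + κB) * l ^ 3 / Λm ^ 3 * X₀s) = (l ^ 3 / Λm ^ 3) * (x * ((κA + κB) * X₀s)) := by ring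
      rw [e1, e2]; exact mul_le_mul_of_nonneg_left hκX (by positivity)
    nlinarith only [t1, t2, t3, t4]
  have br2 : (Real.sqrt 2 * ℓ) ^ 2 * X₂ + 2 * (Av1 * ((Real.sqrt 2 * ℓ) * X₁)) + Av2 * X₀ ≤ (Real.sqrt 2 * ℓ) ^ 2 * X₂s + 2 * (Av1 * ((Real.sqrt 2 * ℓ) * X₁s)) + Av2 * X₀s := by
    have t0 : X₀ ≤ X₀s := by
      rw [hX₀, div_le_iff₀ hx2]; exact le_mul_of_one_le_right hX₀0 (one_le_pow₀ hx)
    have t1 := mul_le_mul_of_nonneg_left hX₂ (by positivity : 0 ≤ (Real.sqrt 2 * ℓ) ^ 2)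
    have t2 := mul_le_mul_of_nonneg_left (mul_le_mul_of_nonneg_left hX₁ (by positivity : 0 ≤ Real.sqrt 2 * ℓ)) hAv1
    have t3 := mul_le_mul_of_nonneg_left t0 hAv2
    linarith only [t1, t2, t3]
  -- rate factors
  have r3 : ∀ {σ : ℝ}, 0 < σ → (1 : ℝ) / (4 / (σ / x * L)) ^ 3 = (1 / (4 / (σ * L)) ^ 3) / x ^ 3 := fun {σ} hσ => by field_simp
  have r2 : (1 : ℝ) / (4 / (ρ₃ / x * L)) ^ 2 = (1 / (4 / (ρ₃ * L)) ^ 2) / x ^ 2 := by field_simp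
  -- group by group
  have g0 : c₀ * X₀ = (c₀ * X₀s) / x ^ 2 := by rw [hX₀]; ring
  have gt : Tt / (4 / (s₀ * P)) ^ 3 = (Tts / (4 / (s₀ * P)) ^ 3) / x ^ 2 := by rw [hTt]; field_simp
  have gx : ∀ {Br Brs σ : ℝ}, 0 ≤ Brs → 0 < σ → Br ≤ x * Brs → c₀ * Br / (4 / (σ / x * L)) ^ 3 ≤ (c₀ * Brs / (4 / (σ * L)) ^ 3) / x ^ 2 := by
    intro Br Brs σ hBrs hσ hBr
    have hden : 0 < (4 / (σ * L)) ^ 3 := by positivity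
    rw [div_eq_mul_one_div (c₀ * Br), r3 hσ]
    have e : (c₀ * Brs / (4 / (σ * L)) ^ 3) / x ^ 2 = c₀ * (x * Brs) * ((1 / (4 / (σ * L)) ^ 3) / x ^ 3) := by field_simp
    rw [e]
    exact mul_le_mul_of_nonneg_right (mul_le_mul_of_nonneg_left hBr hc₀) (by positivity)
  have g2 : c₀ * ((Real.sqrt 2 * ℓ) ^ 2 * X₂ + 2 * (Av1 * ((Real.sqrt 2 * ℓ) * X₁)) + Av2 * X₀) / (4 / (ρ₃ / x * L)) ^ 2 ≤
      (c₀ * ((Real.sqrt 2 * ℓ) ^ 2 * X₂s + 2 * (Av1 * ((Real.sqrt 2 * ℓ) * X₁s)) + Av2 * X₀s) / (4 / (ρ₃ * L)) ^ 2) / x ^ 2 := by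
    rw [div_eq_mul_one_div (c₀ * _), r2]
    have e : (c₀ * ((Real.sqrt 2 * ℓ) ^ 2 * X₂s + 2 * (Av1 * ((Real.sqrt 2 * ℓ) * X₁s)) + Av2 * X₀s) / (4 / (ρ₃ * L)) ^ 2) / x ^ 2 =
        c₀ * ((Real.sqrt 2 * ℓ) ^ 2 * X₂s + 2 * (Av1 * ((Real.sqrt 2 * ℓ) * X₁s)) + Av2 * X₀s) * ((1 / (4 / (ρ₃ * L)) ^ 2) / x ^ 2) := by
      field_simp
    rw [e]
    exact mul_le_mul_of_nonneg_right (mul_le_mul_of_nonneg_left br2 hc₀) (by positivity)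
  have g1 := gx (σ := ρ) (by positivity) hρ (br3 hℓ₁ hAe1 hAe2)
  have gn := gx (σ := ρ₂) (by positivity) hρ₂ (br3 hℓ hAn1 hAn2)
  have gv := gx (σ := ρ₂) (by positivity) hρ₂ (br3 hℓ hAv1 hAv2)
  rw [g0, gt, add_div, add_div, add_div, add_div, add_div]
  linarith only [g1, gn, g2, gv]

end Amp

end Summit.HubbardSuperconductivity.HubbardSuperconductivity.Theorems.TorusFourierL2

end
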